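import Summits.AtomisticToContinuum.FouriersLaw.Theorems.VanishingNoiseTransferVanishingNoiseBoundFlipAsymmetryTransferPinned

/-!
# Stub S2b `stub_nessFlipAsymmetryLipschitz` (line `fekete-usc-one-length`): two reductions

`--supports stmt-AtomisticToContinuum-11976` helper file (crux `VanishingNoiseBound`, route
`VanishingNoiseTransfer`). Input (AS) of the landed `of_uniformAsymmetryTransfer` — the flip-odd
part of the unique weak steady state `μ0 (T+δ/2) (T-δ/2)` of `pinnedChain ω₂ lam β γ` is `O(δ)` in
the `e^{θ_δ H}`-weighted dual norm, `θ_δ = 1/(2 max(T+δ/2, T-δ/2))` — is reduced in two steps: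

* `nessFlipAsymmetryLipschitz_of_nearGibbs` — **(AS) ⟸ (LIP)**: it suffices that `μ0 (T+δ/2) (T-δ/2)`
  be within `C|δ|` of the Gibbs measure `gibbsMeasure N T` on continuous `|g| ≤ e^{θ_δ H}`
  (`flipAsymmetry_le_of_near_flipInvariant`: the Gibbs measure is flip-invariant and integrates
  `e^{θ_δ H}` since `θ_δ ≤ 1/(2T) < 1/T`; `μ0` integrates it because, by weak uniqueness, it is
  the CEHR invariant measure, `θ_δ < 1/max`).
* `abs_integral_sub_le_of_geometric_contraction` — **the abstract lever for (LIP)**, a three-line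
  fact about Markov kernels: if `Q` contracts `f` geometrically towards `μ(f)` in the `V`-weighted
  sup norm (`|Qⁿ f - μ(f)| ≤ C ρⁿ V`) and a probability measure `π` with `π(V) < ∞` is `ε`-almost
  `Q`-invariant on measurable `|g| ≤ V` (`|π(Qg) - π(g)| ≤ ε`), then `|π(f) - μ(f)| ≤ C ε/(1-ρ)`
  (telescoping `π(f) - π(Qⁿf) = Σ_{k<n} (π - πQ)(Q^k f - μ f)`). With `Q = P^δ_1` (time-one kernel
  at temperatures `(T+δ/2, T-δ/2)`), `μ = μ0_δ`, `π = gibbsMeasure N T`, (LIP) follows from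
  (UH) the exponential convergence (2.5) with constants UNIFORM for `|δ| < δ₀` and
  (E) `‖G_T P^δ_1 - G_T‖_{θ_δ} = O(δ)` (the Gibbs measure at `T` is an `O(δ)`-approximate steady
  state at `(T+δ/2, T-δ/2)`: `L̂_δ ρ_T + 2γρ_T = (γδ/2T²)(p_0² - p_{N-1}²)ρ_T`); with `Q = P^T_1`,
  `μ = G_T`, `π = μ0_δ` it follows instead from (2.5) at `(T,T)` (in the tree) and
  (E') `‖μ0_δ P^T_1 - μ0_δ‖_{θ} = O(δ)` (regularity of the transition kernel in the bath
  temperatures, integrated against the steady state — the hypoelliptic input).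

No definitions.
-/

noncomputable section

namespace Summit.AtomisticToContinuum.FouriersLaw.Theorems.FixedLengthNoiseContinuity

open MeasureTheory ProbabilityTheory Filter Topology Set
open scoped NNReal ENNReal
open Literature.MathematicalPhysics.KineticTheory.HeatConduction

/-! ## §1 The abstract lever: an invariant measure is as close to `π` as `π` is to being invariant -/

section Abstract

variable {α : Type*} [MeasurableSpace α]

/-- **Geometric contraction transfers approximate invariance to closeness of the means.** Let `Q`
be a Markov kernel, `V ≥ 0` with `π(V) < ∞` for a probability measure `π`, and suppose `π` is
`ε`-almost `Q`-invariant on measurable `|g| ≤ V`: `|∫ Qg dπ - ∫ g dπ| ≤ ε`. If a sequence of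
measurable functions `F k` (think `F k = Q^k f - μ(f)`) satisfies `F (k+1) = Q (F k)` and
`|F k| ≤ C ρ^k V` with `0 ≤ ρ < 1`, then `|∫ F 0 dπ| ≤ C ε / (1 - ρ)`: indeed
`π(F 0) - π(F n) = Σ_{k<n} (π(F k) - π(Q F k))`, each term at most `C ρ^k ε`, and
`|π(F n)| ≤ C ρⁿ π(V) → 0`. [folklore] -/
theorem abs_integral_le_of_geometric_contraction (Q : Kernel α α) (π : Measure α)
    [IsProbabilityMeasure π] {V : α → ℝ} (hV0 : ∀ x, 0 ≤ V x) (hπV : Integrable V π) {C ρ ε : ℝ}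
    (hC : 0 ≤ C) (hρ0 : 0 ≤ ρ) (hρ1 : ρ < 1)
    (hE : ∀ g : α → ℝ, Measurable g → (∀ x, |g x| ≤ V x) →
      |∫ x, (∫ y, g y ∂(Q x)) ∂π - ∫ x, g x ∂π| ≤ ε)
    (F : ℕ → α → ℝ) (hFm : ∀ k, Measurable (F k)) (hFb : ∀ k x, |F k x| ≤ C * ρ ^ k * V x)
    (hFstep : ∀ k x, F (k + 1) x = ∫ y, F k y ∂(Q x)) :
    |∫ x, F 0 x ∂π| ≤ C * ε / (1 - ρ) := by
  -- `ε ≥ 0` (test `g = 0`)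
  have hε : 0 ≤ ε := by
    have h := hE (fun _ => 0) measurable_const fun x => by rw [abs_zero]; exact hV0 x
    simpa using h
  -- the scaled almost-invariance: `|g| ≤ λ V ⟹ |π(Qg) - π(g)| ≤ λ ε`
  have hE' : ∀ (lam : ℝ), 0 ≤ lam → ∀ g : α → ℝ, Measurable g → (∀ x, |g x| ≤ lam * V x) →
      |∫ x, (∫ y, g y ∂(Q x)) ∂π - ∫ x, g x ∂π| ≤ lam * ε := by
    intro lam hlam g hg hgb
    rcases hlam.eq_or_lt with h0 | hpos
    · -- `lam = 0`: `g = 0`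
      have hg0 : g = fun _ => 0 := funext fun x => by
        have := hgb x; rw [← h0, zero_mul] at this; exact abs_nonpos_iff.1 this
      subst hg0
      simp [← h0]
    · have h := hE (fun x => g x / lam) (hg.div_const lam) fun x => by
        rw [abs_div, abs_of_pos hpos, div_le_iff₀ hpos, mul_comm]; exact hgb x
      have h1 : ∀ x, ∫ y, g y / lam ∂(Q x) = (∫ y, g y ∂(Q x)) / lam := fun x => integral_div lam _
      simp_rw [h1] at h
      rw [integral_div, integral_div, ← sub_div, abs_div, abs_of_pos hpos, div_le_iff₀ hpos] at h
      linarith [mul_comm lam ε]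
  -- one telescoping step
  set a : ℕ → ℝ := fun k => ∫ x, F k x ∂π with ha
  have hstep : ∀ k, |a k - a (k + 1)| ≤ C * ρ ^ k * ε := by
    intro k
    have h := hE' (C * ρ ^ k) (by positivity) (F k) (hFm k) (hFb k)
    have hk1 : a (k + 1) = ∫ x, (∫ y, F k y ∂(Q x)) ∂π := by
      simp only [ha]; exact integral_congr_ae (Eventually.of_forall fun x => hFstep k x)
    rw [hk1, abs_sub_comm]
    exact h
  -- the telescoped bound `|a 0 - a n| ≤ C ε Σ_{k<n} ρ^k ≤ C ε / (1 - ρ)`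
  have hgeom : ∀ n, ∑ k ∈ Finset.range n, ρ ^ k ≤ 1 / (1 - ρ) := by
    intro n
    have hs := summable_geometric_of_lt_one hρ0 hρ1
    calc ∑ k ∈ Finset.range n, ρ ^ k ≤ ∑' k, ρ ^ k :=
          hs.sum_le_tsum (Finset.range n) fun k _ => pow_nonneg hρ0 k
      _ = 1 / (1 - ρ) := by rw [tsum_geometric_of_lt_one hρ0 hρ1, one_div]
  have htel : ∀ n, |a 0 - a n| ≤ C * ε * ∑ k ∈ Finset.range n, ρ ^ k := by
    intro n
    induction n with
    | zero => simp
    | succ n ih =>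
      rw [Finset.sum_range_succ, mul_add]
      calc |a 0 - a (n + 1)| = |(a 0 - a n) + (a n - a (n + 1))| := by ring_nf
        _ ≤ |a 0 - a n| + |a n - a (n + 1)| := abs_add_le _ _
        _ ≤ C * ε * ∑ k ∈ Finset.range n, ρ ^ k + C * ρ ^ n * ε := add_le_add ih (hstep n)
        _ = C * ε * ∑ k ∈ Finset.range n, ρ ^ k + C * ε * ρ ^ n := by ring
  have htel' : ∀ n, |a 0 - a n| ≤ C * ε / (1 - ρ) := fun n =>
    (htel n).trans (by
      have := mul_le_mul_of_nonneg_left (hgeom n) (mul_nonneg hC hε)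
      rwa [mul_one_div] at this)
  -- the tail `|a n| ≤ C ρⁿ π(V)`
  have htail : ∀ n, |a n| ≤ C * ρ ^ n * ∫ x, V x ∂π := by
    intro n
    simp only [ha]
    rw [← integral_const_mul]
    refine (abs_integral_le_integral_abs).trans (integral_mono_of_nonneg
      (Eventually.of_forall fun x => abs_nonneg _) (hπV.const_mul _)
      (Eventually.of_forall fun x => hFb n x))
  -- conclusion: `|a 0| ≤ C ε/(1-ρ) + C ρⁿ π(V)` for all `n`, and `ρⁿ → 0`
  have hbound : ∀ n, |a 0| ≤ C * ε / (1 - ρ) + C * ρ ^ n * ∫ x, V x ∂π := fun n =>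
    calc |a 0| = |(a 0 - a n) + a n| := by ring_nf
      _ ≤ |a 0 - a n| + |a n| := abs_add_le _ _
      _ ≤ _ := add_le_add (htel' n) (htail n)
  have hlim : Tendsto (fun n : ℕ => C * ε / (1 - ρ) + C * ρ ^ n * ∫ x, V x ∂π) atTop
      (𝓝 (C * ε / (1 - ρ) + C * 0 * ∫ x, V x ∂π)) :=
    tendsto_const_nhds.add (((tendsto_pow_atTop_nhds_zero_of_lt_one hρ0 hρ1).const_mul C).mul_const _)
  rw [mul_zero, zero_mul, add_zero] at hlim
  exact ge_of_tendsto' hlim hbound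

end Abstract

/-! ## §2 (AS) from closeness to the Gibbs measure at `T` -/

section NearGibbs

variable {ω₂ lam β γ : ℝ}

/-- **(AS) ⟸ (LIP).** For the unique weak steady family `μ0` of `pinnedChain ω₂ lam β γ` (all
parameters positive) and `T > 0`: if `μ0 (T+δ/2) (T-δ/2)` is within `C|δ|` of the Gibbs measure
`gibbsMeasure N T` on continuous `|g| ≤ e^{θ_δ H}` (`θ_δ = 1/(2 max(T+δ/2, T-δ/2))`) for
`0 < |δ| < δ₁`, then its flip-odd part is bounded by `2C|δ|` on the same class for
`0 < |δ| < min δ₁ T` — the conclusion of stub S2b `stub_nessFlipAsymmetryLipschitz`. Proof: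
`flipAsymmetry_le_of_near_flipInvariant` with the flip-invariant reference `ν = gibbsMeasure N T`
(`measurePreserving_momentumFlip_gibbsMeasure`), which integrates `e^{θ_δ H}` as `θ_δ ≤ 1/(2T) < 1/T`;
`μ0 (T+δ/2) (T-δ/2)` integrates it because by weak uniqueness it is the invariant probability
measure of `pinnedChainSemigroup` (CEHR 2018 Thm 2.13 (2), `θ_δ < 1/max(T+δ/2, T-δ/2)`). -/
theorem nessFlipAsymmetryLipschitz_of_nearGibbs (hω : 0 < ω₂) (hl : 0 < lam) (hβ : 0 < β)
    (hγ : 0 < γ) {T : ℝ} (hT : 0 < T) {N : ℕ} (μ0 : ℝ → ℝ → Measure (PhaseSpace N))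
    (hμ0 : ∀ T_L T_R : ℝ, 0 < T_L → 0 < T_R →
      (pinnedChain ω₂ lam β γ).IsSteadyState N T_L T_R (μ0 T_L T_R) ∧
        ∀ ν : Measure (PhaseSpace N),
          (pinnedChain ω₂ lam β γ).IsSteadyState N T_L T_R ν → ν = μ0 T_L T_R)
    (hLIP : ∃ C δ₁ : ℝ, 0 < δ₁ ∧ ∀ δ : ℝ, δ ≠ 0 → |δ| < δ₁ →
      ∀ g : PhaseSpace N → ℝ, Continuous g →
        (∀ y, |g y| ≤ Real.exp (1 / max (T + δ / 2) (T - δ / 2) / 2 *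
          (pinnedChain ω₂ lam β γ).hamiltonian N y)) →
        |∫ y, g y ∂(μ0 (T + δ / 2) (T - δ / 2)) -
            ∫ y, g y ∂((pinnedChain ω₂ lam β γ).gibbsMeasure N T)| ≤ C * |δ|) :
    ∃ C δ₁ : ℝ, 0 < δ₁ ∧ ∀ δ : ℝ, δ ≠ 0 → |δ| < δ₁ →
      ∀ (i : Fin N) (h : PhaseSpace N → ℝ), Continuous h →
        (∀ y, |h y| ≤ Real.exp (1 / max (T + δ / 2) (T - δ / 2) / 2 *
          (pinnedChain ω₂ lam β γ).hamiltonian N y)) →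
        |∫ y, h (momentumFlip i y) ∂(μ0 (T + δ / 2) (T - δ / 2)) -
            ∫ y, h y ∂(μ0 (T + δ / 2) (T - δ / 2))| ≤ C * |δ| := by
  obtain ⟨C, δ₁, hδ₁, hL⟩ := hLIP
  refine ⟨2 * C, min δ₁ T, lt_min hδ₁ hT, fun δ hδ0 hδ i h hh hhb => ?_⟩
  -- `N = 0`: no site to flip
  rcases Nat.eq_zero_or_pos N with hN0 | hN
  · subst hN0; exact Fin.elim0 i
  have hδ₁' : |δ| < δ₁ := hδ.trans_le (min_le_left _ _)
  have hδT : |δ| < T := hδ.trans_le (min_le_right _ _)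
  have hTL : 0 < T + δ / 2 := by cases abs_lt.1 hδT; linarith
  have hTR : 0 < T - δ / 2 := by cases abs_lt.1 hδT; linarith
  set P := pinnedChain ω₂ lam β γ with hPdef
  set θ : ℝ := 1 / max (T + δ / 2) (T - δ / 2) / 2 with hθdef
  have hmaxT : T ≤ max (T + δ / 2) (T - δ / 2) := by
    rcases le_or_gt 0 δ with hd | hd
    · exact le_trans (by linarith) (le_max_left _ _)
    · exact le_trans (by linarith) (le_max_right _ _)
  have hmax0 : 0 < max (T + δ / 2) (T - δ / 2) := hT.trans_le hmaxT
  have hθ0 : 0 < θ := by positivity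
  have hθmax : θ < 1 / max (T + δ / 2) (T - δ / 2) := by
    rw [hθdef]; exact half_lt_self (by positivity)
  have hθT : θ < 1 / T := by
    have h1 : 1 / max (T + δ / 2) (T - δ / 2) ≤ 1 / T := one_div_le_one_div_of_le hT hmaxT
    exact hθmax.trans_le h1
  -- the reference measure: Gibbs at `T`, flip-invariant, integrates `e^{θH}`
  have hν : ∀ j : Fin N, MeasurePreserving (momentumFlip j) (P.gibbsMeasure N T) (P.gibbsMeasure N T) :=
    fun j => P.measurePreserving_momentumFlip_gibbsMeasure N T j
  have hVν : Integrable (fun y => Real.exp (θ * P.hamiltonian N y)) (P.gibbsMeasure N T) :=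
    pinnedChain_integrable_exp_mul_hamiltonian_gibbsMeasure hω hl.le hβ.le γ N hT hθT
  -- the steady state integrates `e^{θH}`: it is the CEHR invariant measure, by weak uniqueness
  have hVμ : Integrable (fun y => Real.exp (θ * P.hamiltonian N y)) (μ0 (T + δ / 2) (T - δ / 2)) := by
    obtain ⟨-, μs, hμs, hinv, hrest⟩ := pinnedChainSemigroup_ergodic hω hl.le hβ hγ hN hTL hTR
    have hm : 0 < 1 / max (T + δ / 2) (T - δ / 2) := by positivity
    have hss : P.IsSteadyState N (T + δ / 2) (T - δ / 2) μs :=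
      pinnedChain_isSteadyState_of_isInvariant hω.le hl.le hβ.le γ N _ hinv (half_pos hm)
        (hrest _ (half_pos hm) (half_lt_self hm)).1
    rw [← (hμ0 _ _ hTL hTR).2 μs hss]
    exact (hrest θ hθ0 hθmax).1
  have hnear : ∀ g : PhaseSpace N → ℝ, Continuous g →
      (∀ y, |g y| ≤ Real.exp (θ * P.hamiltonian N y)) →
      |∫ y, g y ∂(μ0 (T + δ / 2) (T - δ / 2)) - ∫ y, g y ∂(P.gibbsMeasure N T)| ≤ C * |δ| :=
    fun g hg hgb => hL δ hδ0 hδ₁' g hg hgb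
  have key := flipAsymmetry_le_of_near_flipInvariant (ω₂ := ω₂) (lam := lam) (β := β) (γ := γ)
    (P.gibbsMeasure N T) (μ0 (T + δ / 2) (T - δ / 2)) hν hVν hVμ hnear i h hh hhb
  calc |∫ y, h (momentumFlip i y) ∂(μ0 (T + δ / 2) (T - δ / 2)) -
          ∫ y, h y ∂(μ0 (T + δ / 2) (T - δ / 2))| ≤ 2 * (C * |δ|) := key
    _ = 2 * C * |δ| := by ring

end NearGibbs


/-- Registered helper sub-goal `helper_nessLipschitzReduction` of stmt-AtomisticToContinuum-11976
(= `nessFlipAsymmetryLipschitz_of_nearGibbs`, fully quantified, notation-free one-line form: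
stub S2b `stub_nessFlipAsymmetryLipschitz` ⟸ (LIP)). -/
theorem helper_nessLipschitzReduction : ∀ (ω₂ lam β γ : ℝ), 0 < ω₂ → 0 < lam → 0 < β → 0 < γ → ∀ (T : ℝ), 0 < T → ∀ (N : ℕ) (μ0 : ℝ → ℝ → MeasureTheory.Measure (Literature.MathematicalPhysics.KineticTheory.HeatConduction.PhaseSpace N)), (∀ T_L T_R : ℝ, 0 < T_L → 0 < T_R → (Literature.MathematicalPhysics.KineticTheory.HeatConduction.pinnedChain ω₂ lam β γ).IsSteadyState N T_L T_R (μ0 T_L T_R) ∧ ∀ ν : MeasureTheory.Measure (Literature.MathematicalPhysics.KineticTheory.HeatConduction.PhaseSpace N), (Literature.MathematicalPhysics.KineticTheory.HeatConduction.pinnedChain ω₂ lam β γ).IsSteadyState N T_L T_R ν → ν = μ0 T_L T_R) → (∃ C δ₁ : ℝ, 0 < δ₁ ∧ ∀ δ : ℝ, δ ≠ 0 → |δ| < δ₁ → ∀ g : Literature.MathematicalPhysics.KineticTheory.HeatConduction.PhaseSpace N → ℝ, Continuous g → (∀ y, |g y| ≤ Real.exp (1 / max (T + δ / 2) (T - δ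 / 2) / 2 * (Literature.MathematicalPhysics.KineticTheory.HeatConduction.pinnedChain ω₂ lam β γ).hamiltonian N y)) → |MeasureTheory.integral (μ0 (T + δ / 2) (T - δ / 2)) (fun y => g y) - MeasureTheory.integral ((Literature.MathematicalPhysics.KineticTheory.HeatConduction.pinnedChain ω₂ lam β γ).gibbsMeasure N T) (fun y => g y)| ≤ C * |δ|) → ∃ C δ₁ : ℝ, 0 < δ₁ ∧ ∀ δ : ℝ, δ ≠ 0 → |δ| < δ₁ → ∀ (i : Fin N) (h : Literature.MathematicalPhysics.KineticTheory.HeatConduction.PhaseSpace N → ℝ), Continuous h → (∀ y, |h y| ≤ Real.exp (1 / max (T + δ / 2) (T - δ / 2) / 2 * (Literature.MathematicalPhysics.KineticTheory.HeatConduction.pinnedChain ω₂ lam β γ).hamiltonian N y)) → |MeasureTheory.integral (μ0 (T + δ / 2) (T - δ / 2)) (fun y => h (Literature.MathematicalPhysics.KineticTheory.HeatConduction.momentumFlip i y)) - MeasureTheory.integral (μ0 (T + δ / 2) (T - δ / 2)) (fun y => h y)| ≤ C * |δ| :=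
  fun _ _ _ _ hω hl hβ hγ _ hT _ μ0 hμ0 hLIP =>
    nessFlipAsymmetryLipschitz_of_nearGibbs hω hl hβ hγ hT μ0 hμ0 hLIP

end Summit.AtomisticToContinuum.FouriersLaw.Theorems.FixedLengthNoiseContinuity

end
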